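import Summits.CriticalPhenomena.PercolationContinuityZ3.Theorems.PercNearOneGluingNoHeavyLowerTailSahiSunflowerAllOrders
import Mathlib.Tactic.FinCases
import Mathlib.Tactic.Linarith
import Mathlib.Tactic.Ring
import HarnessLib

/-!
# `NoHeavyLowerTail` (crux stmt-CriticalPhenomena-4575), master-family line P2 (Sahi's algebraic route):
# on the seven-point poset `P7 = {0,1}³ ∖ {010}` of three events with ONE covering relation `B ⊆ A ∪ C`,
# Sahi positivity of EVERY order is `SahiPositive 2 ∧ (one cubic)`

Support file (seat `prim-masterthm-p2`, gen 2; `--supports stmt-CriticalPhenomena-4575`); new mathematics, not in print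
(memo `run/shared/lean/prim/prim-masterthm/prim-masterthm-p2/SAHI-ROUTE.md` §4.6–4.7); no named fact, no sorry.
Sequel of `…SahiSunflowerAllOrders.lean` (`M3.sahiPositive_m3_iff`: on the five-point poset `M₃` all orders ⟺ one cubic);
the transfer to events / product measures / the E3GRP rows is in the companion files `…SahiCoveringTriplePattern.lean`,
`…SahiCoveringTripleRows.lean`.

SETTING.  Three events `A, B, C` of a finite probability space with `B ⊆ A ∪ C` (the middle event is COVERED by the
other two).  The pattern `(1_A, 1_B, 1_C)` then omits `010`, so it lives in the seven-point poset `P7 = {0,1}³ ∖ {010}`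
(coordinatewise order): `bot = 000`, two "hanging" cells `hA = 100`, `hC = 001`, three "pair" cells `pA = 011`, `pB = 101`,
`pC = 110` (`p_X` = "only `X` fails"), `top = 111`.  EVERY E3GRP row has this shape after a permutation of its slots
(machine enumeration over the `52 / 15 / 5` terminal patterns, memo §4.3(e)): the nine five-terminal rows `r0–r8` of
`E3GroupSepCert.row` realise `7, 6, 6, 7, 5, 5, 5, 6, 6` cells, the 4-point classes `α, β, γ` and the 3-point rows `3PT-LB`,
`T_inc` at most `6`; the sunflower poset `M₃` of the prequel is the sub-poset `{bot, pA, pB, pC, top}`.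

**Theorem (`P7.sahiPositive_iff_two_and_cubic`).**  For every probability weight `ν` on `P7`:
`(∀ n, SahiPositive ν n) ↔ SahiPositive ν 2 ∧ 0 ≤ E₃(χ_{U_A}, χ_{U_B}, χ_{U_C})`, where `U_A, U_B, U_C` are the three
coordinate up-sets (the events themselves).  So on such an algebra Sahi's whole hierarchy [Sahi2008, Conj. 5; LiebSahi2021,
Conj. 1.1] is: Harris/FKG for pairs plus the single cubic "row" `E₃(A,B,C) ≥ 0` — nothing of order `≥ 4`, no second cubic.
(On `M₃` even the pair layer followed from the cubic; on `P7` it does not — e.g. weights with `E₂(U_B,U_C) < 0` and row `≥ 0`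
exist — so `SahiPositive 2` is a genuine hypothesis, automatic for monotone images of FKG measures.)

PROOF.  Antichain basis (`sahiPositive_of_antichainBasis₂`, prequel) + kernel classification of the `15` up-sets of `P7`:
three chains cover them (no antichain of `4` up-sets), and the `6` antichain triples are, with `U_A' = U_A ∖ {hA}`,
`U_C' = U_C ∖ {hC}`, `M = U_B ∪ {pB}`, `Q_X = {p_X, top}`:  `(Q_A,Q_B,Q_C)` — `E₃ ≥ 0` for every weight (increasing Δ-system);
the row `(U_A,U_B,U_C)`; the trimmed rows `(U_A',U_B,U_C) = row + ν(hA)·E₂(U_B,U_C)`, `(U_A,U_B,U_C') = row + ν(hC)·E₂(U_A,U_B)`,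
`(U_A',U_B,U_C') = row + ν(hA)E₂(U_B,U_C) + ν(hC)E₂(U_A',U_B)` (DISJOINT-CELL IDENTITY: removing from one slot a cell disjoint
from the other two events raises `E₃` by `mass × E₂(other two)`, cf. `SahiIdentities.sahiE_cons_of_annihilating`); and
`(U_A, M, U_C) = row + ν(pB)·[(1 − νU_A)(1 − νU_C) + 1 − ν(U_A ∩ U_C)]` (adding to the middle slot a cell inside the other two).
All corrections are `≥ 0` given `SahiPositive ν 2`; the identities are checked by `linarith` on the explicit polynomials.
-/

namespace Summit.CriticalPhenomena.PercolationContinuityZ3.Theorems.SahiDeltaSystem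

open Finset Function Literature.Combinatorics.Sahi2008

/-! ## Part 1.  The seven-point poset `P7 = {0,1}³ ∖ {010}` -/

/-- The poset `P7`: patterns `(1_A,1_B,1_C)` of three events with `B ⊆ A ∪ C` — `bot = 000`, `hA = 100`, `hC = 001`,
`pA = 011`, `pB = 101`, `pC = 110`, `top = 111` (`p_X` = "only `X` fails"). [this work] -/
inductive P7 : Type
  | bot | hA | hC | pA | pB | pC | top
  deriving DecidableEq

namespace P7

/-- The coordinatewise order of `P7` as a Boolean table. [this work] -/
def leb : P7 → P7 → Bool
  | bot, _ => true
  | hA, hA => true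
  | hA, pB => true
  | hA, pC => true
  | hA, top => true
  | hC, hC => true
  | hC, pA => true
  | hC, pB => true
  | hC, top => true
  | pA, pA => true
  | pA, top => true
  | pB, pB => true
  | pB, top => true
  | pC, pC => true
  | pC, top => true
  | top, top => true
  | _, _ => false

/-- The order of `P7` (from the table `leb`). [this work] -/
instance : LE P7 := ⟨fun x y => leb x y = true⟩

/-- The order of `P7` is decidable. [this work] -/
instance decLE : DecidableRel (α := P7) (· ≤ ·) := fun x y => inferInstanceAs (Decidable (leb x y = true))

/-- The seven points of `P7`. [this work] -/
instance : Fintype P7 where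
  elems := {bot, hA, hC, pA, pB, pC, top}
  complete := by intro x; cases x <;> simp

/-- `P7` is a partial order (kernel checks on the table). [this work] -/
instance : PartialOrder P7 where
  le := (· ≤ ·)
  le_refl := by decide
  le_trans := by decide
  le_antisymm := by decide

/-- The sum over `P7` written out. [this work] -/
theorem sum_eq (f : P7 → ℝ) : ∑ x, f x = f bot + f hA + f hC + f pA + f pB + f pC + f top := by
  show Finset.sum {bot, hA, hC, pA, pB, pC, top} f = _
  rw [Finset.sum_insert (by decide), Finset.sum_insert (by decide), Finset.sum_insert (by decide),
    Finset.sum_insert (by decide), Finset.sum_insert (by decide), Finset.sum_insert (by decide), Finset.sum_singleton]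
  ring

/-- Up-set-ness of a finite subset of `P7`, in decidable form. [this work] -/
private def IsUp (U : Finset P7) : Prop := ∀ x ∈ U, ∀ y : P7, x ≤ y → y ∈ U

/-- `IsUp` is decidable. [this work] -/
private instance instDecIsUp (U : Finset P7) : Decidable (IsUp U) := by
  unfold IsUp; infer_instance

/-- `IsUpperSet` on `P7` in decidable form. [this work] -/
private theorem isUp_iff (U : Finset P7) : IsUpperSet ((U : Finset P7) : Set P7) ↔ IsUp U := by
  constructor
  · intro h x hx y hxy
    exact h hxy hx
  · intro h x y hxy hx
    exact h x hx y hxy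

/-- `Q_A = {pA, top}` (pull-back: `B ∩ C`). [this work] -/
def QA : Finset P7 := {pA, top}
/-- `Q_B = {pB, top}` (pull-back: `A ∩ C`). [this work] -/
def QB : Finset P7 := {pB, top}
/-- `Q_C = {pC, top}` (pull-back: `A ∩ B`). [this work] -/
def QC : Finset P7 := {pC, top}
/-- `U_A = {hA, pB, pC, top}`: the first coordinate up-set (pull-back: the event `A`). [this work] -/
def UA : Finset P7 := {hA, pB, pC, top}
/-- `U_B = {pA, pC, top}`: the second coordinate up-set (pull-back: `B`). [this work] -/
def UB : Finset P7 := {pA, pC, top}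
/-- `U_C = {hC, pA, pB, top}`: the third coordinate up-set (pull-back: `C`). [this work] -/
def UC : Finset P7 := {hC, pA, pB, top}
/-- `U_A' = U_A ∖ {hA}` (pull-back: `A ∩ (B ∪ C)`). [this work] -/
def UAt : Finset P7 := {pB, pC, top}
/-- `U_C' = U_C ∖ {hC}` (pull-back: `C ∩ (A ∪ B)`). [this work] -/
def UCt : Finset P7 := {pA, pB, top}
/-- `M = {pA, pB, pC, top}` (pull-back: "at least two of `A, B, C`"). [this work] -/
def M : Finset P7 := {pA, pB, pC, top}

/-- The fifteen up-sets of `P7`. [this work] -/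
private def ups : List (Finset P7) :=
  [∅, {top}, QA, QB, QC, UCt, UB, UAt, UA, UC, M, {hA, pA, pB, pC, top}, {hC, pA, pB, pC, top},
    Finset.univ.erase bot, Finset.univ]

set_option maxRecDepth 100000 in
/-- A finite subset of `P7` is an up-set iff it is one of the fifteen listed ones (kernel check over the `128` subsets).
[this work] -/
private theorem isUp_iff_mem_ups (U : Finset P7) : IsUp U ↔ U ∈ ups := by
  revert U; decide

/-- A chain index: up-sets with the same index are nested (three chains cover `Up(P7)`). [this work] -/
private def cix (U : Finset P7) : Fin 3 :=
  if U = QB ∨ U = UAt ∨ U = UA ∨ U = {hA, pA, pB, pC, top} then 1 else if U = QC ∨ U = UB ∨ U = M then 2 else 0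

set_option maxRecDepth 100000 in
/-- Up-sets with the same chain index are nested (kernel check). [this work] -/
private theorem nested_of_cix_eq : ∀ U ∈ ups, ∀ V ∈ ups, cix U = cix V → U ⊆ V ∨ V ⊆ U := by
  decide

/-- Among any `k + 4` up-sets of `P7` two are nested (`Up(P7)` has width `3`). [this work] -/
theorem nested_of_four {k : ℕ} (U : Fin (k + 4) → Finset P7) (hU : ∀ i, IsUpperSet ((U i : Finset P7) : Set P7)) :
    ∃ i j, i ≠ j ∧ U j ⊆ U i := by
  have hcard : Fintype.card (Fin 3) < Fintype.card (Fin (k + 4)) := by simp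
  obtain ⟨i, j, hij, hc⟩ := Fintype.exists_ne_map_eq_of_card_lt (fun i => cix (U i)) hcard
  rcases nested_of_cix_eq (U i) ((isUp_iff_mem_ups _).1 ((isUp_iff _).1 (hU i))) (U j)
      ((isUp_iff_mem_ups _).1 ((isUp_iff _).1 (hU j))) hc with h | h
  · exact ⟨j, i, hij.symm, h⟩
  · exact ⟨i, j, hij, h⟩

/-- The `36` ordered antichain triples of up-sets of `P7`: the orderings of `(Q_A,Q_B,Q_C)`, of the row
`(U_A,U_B,U_C)`, of the three trimmed rows and of `(U_A, M, U_C)`. [this work] -/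
def tripleList : List (Finset P7 × Finset P7 × Finset P7) :=
  [(QA, QB, QC), (QA, QC, QB), (QB, QA, QC), (QB, QC, QA), (QC, QA, QB), (QC, QB, QA), (UCt, UB, UAt),
    (UCt, UAt, UB), (UB, UCt, UAt), (UB, UAt, UCt), (UAt, UCt, UB), (UAt, UB, UCt), (UCt, UB, UA), (UCt, UA, UB),
    (UB, UCt, UA), (UB, UA, UCt), (UA, UCt, UB), (UA, UB, UCt), (UC, UB, UAt), (UC, UAt, UB), (UB, UC, UAt),
    (UB, UAt, UC), (UAt, UC, UB), (UAt, UB, UC), (UC, UB, UA), (UC, UA, UB), (UB, UC, UA), (UB, UA, UC),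
    (UA, UC, UB), (UA, UB, UC), (UC, UA, M), (UC, M, UA), (UA, UC, M), (UA, M, UC), (M, UC, UA), (M, UA, UC)]

set_option maxRecDepth 100000 in
/-- Classification of the antichain triples of up-sets of `P7` (kernel check over the `15³` triples). [this work] -/
private theorem antichain_three_mem : ∀ U ∈ ups, ∀ V ∈ ups, ∀ X ∈ ups,
    ¬ U ⊆ V → ¬ V ⊆ U → ¬ U ⊆ X → ¬ X ⊆ U → ¬ V ⊆ X → ¬ X ⊆ V → (U, V, X) ∈ tripleList := by
  decide

/-- The coordinate up-sets are up-sets. [this work] -/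
theorem isUpperSet_UA : IsUpperSet ((UA : Finset P7) : Set P7) := by rw [isUp_iff, isUp_iff_mem_ups]; decide
/-- The coordinate up-sets are up-sets. [this work] -/
theorem isUpperSet_UB : IsUpperSet ((UB : Finset P7) : Set P7) := by rw [isUp_iff, isUp_iff_mem_ups]; decide
/-- The coordinate up-sets are up-sets. [this work] -/
theorem isUpperSet_UC : IsUpperSet ((UC : Finset P7) : Set P7) := by rw [isUp_iff, isUp_iff_mem_ups]; decide
/-- `U_A'` is an up-set. [this work] -/
theorem isUpperSet_UAt : IsUpperSet ((UAt : Finset P7) : Set P7) := by rw [isUp_iff, isUp_iff_mem_ups]; decide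

section Weight

variable (ν : P7 → ℝ)

/-- `E(f)` on `P7`, cell by cell (the simp set used below). [this work] -/
theorem ex_eq (f : P7 → ℝ) : ex ν f = ν bot * f bot + ν hA * f hA + ν hC * f hC + ν pA * f pA + ν pB * f pB +
    ν pC * f pC + ν top * f top := by
  rw [ex_def, sum_eq]

/-- Total mass one, written out. [this work] -/
theorem sum_one_eq {ν : P7 → ℝ} (hν1 : ∑ x, ν x = 1) : ν bot + ν hA + ν hC + ν pA + ν pB + ν pC + ν top = 1 := by
  rw [← sum_eq]; exact hν1

/-- A pair inequality out of `SahiPositive ν 2`, for two named up-sets. [this work] -/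
theorem sahiE_two_nonneg_of_two {ν : P7 → ℝ} (h2 : SahiPositive ν 2) {U V : Finset P7}
    (hU : IsUpperSet ((U : Finset P7) : Set P7)) (hV : IsUpperSet ((V : Finset P7) : Set P7)) :
    0 ≤ sahiE ν 2 ![setInd U, setInd V] := by
  have h := (sahiPositive_iff_indicators ν 2).1 h2 ![U, V] (fun i => by fin_cases i <;> assumption)
  have e : (fun i => setInd ((![U, V] : Fin 2 → Finset P7) i)) = ![setInd U, setInd V] := by
    funext i; fin_cases i <;> rfl
  rw [e] at h
  exact h

/-- **`E₃(Q_A,Q_B,Q_C) ≥ 0` for every probability weight** (`= t(1−t)(2−t−Σq) + t·e₂(q) + e₃(q)`, `t = ν(top)`,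
`q_X = ν(p_X)`; the increasing Δ-system triple, cf. `sahiE3_sunflower_nonneg`). [this work] -/
theorem sahiE_three_Q_nonneg {ν : P7 → ℝ} (hν0 : ∀ x, 0 ≤ ν x) (hν1 : ∑ x, ν x = 1) :
    0 ≤ sahiE ν 3 ![setInd QA, setInd QB, setInd QC] := by
  have hs := sum_one_eq hν1
  have hb := hν0 bot; have hza := hν0 hA; have hzc := hν0 hC; have hqa := hν0 pA; have hqb := hν0 pB
  have hqc := hν0 pC; have ht := hν0 top
  have key : 0 ≤ ν top * (1 - ν top) * (2 - ν top - ν pA - ν pB - ν pC) :=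
    mul_nonneg (mul_nonneg ht (by linarith)) (by linarith)
  rw [sahiE_three]
  simp [ex_eq, setInd_apply, QA, QB, QC]
  linarith [key, mul_nonneg ht (mul_nonneg hqa hqb), mul_nonneg ht (mul_nonneg hqa hqc), mul_nonneg ht (mul_nonneg hqb hqc),
    mul_nonneg hqa (mul_nonneg hqb hqc)]

/-- **Order 3 on the antichain triples.**  Every ordered antichain triple of up-sets of `P7` has `E₃ ≥ 0` once
`SahiPositive ν 2` and the row cubic `E₃(χ_{U_A}, χ_{U_B}, χ_{U_C}) ≥ 0` hold (disjoint-cell identities, see the module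
docstring). [this work] -/
theorem sahiE_three_nonneg_of_mem_tripleList {ν : P7 → ℝ} (hν0 : ∀ x, 0 ≤ ν x) (hν1 : ∑ x, ν x = 1)
    (h2 : SahiPositive ν 2) (h3 : 0 ≤ sahiE ν 3 ![setInd UA, setInd UB, setInd UC]) {U V X : Finset P7}
    (hUVX : (U, V, X) ∈ tripleList) : 0 ≤ sahiE ν 3 ![setInd U, setInd V, setInd X] := by
  have hs := sum_one_eq hν1
  have hb := hν0 bot; have hza := hν0 hA; have hzc := hν0 hC; have hqa := hν0 pA; have hqb := hν0 pB
  have hqc := hν0 pC; have ht := hν0 top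
  have hQ := sahiE_three_Q_nonneg hν0 hν1
  have hrow := h3
  -- the three pair inequalities used by the trimmed rows
  have hBC := sahiE_two_nonneg_of_two h2 isUpperSet_UB isUpperSet_UC
  have hAB := sahiE_two_nonneg_of_two h2 isUpperSet_UA isUpperSet_UB
  have hAtB := sahiE_two_nonneg_of_two h2 isUpperSet_UAt isUpperSet_UB
  rw [sahiE_two] at hBC hAB hAtB
  simp [ex_eq, setInd_apply, UA, UB, UC, UAt] at hBC hAB hAtB
  have kA := mul_nonneg hza (sub_nonneg.mpr hBC)
  have kC := mul_nonneg hzc (sub_nonneg.mpr hAB)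
  have kCt := mul_nonneg hzc (sub_nonneg.mpr hAtB)
  -- the correction of the `(U_A, M, U_C)` triple
  have f1 : 0 ≤ 1 - (ν hA + ν pB + ν pC + ν top) := by linarith
  have f2 : 0 ≤ 1 - (ν hC + ν pA + ν pB + ν top) := by linarith
  have f3 : 0 ≤ 1 - (ν pB + ν top) := by linarith
  have kM := mul_nonneg hqb (mul_nonneg f1 f2)
  have kM' := mul_nonneg hqb f3
  rw [sahiE_three] at hQ hrow
  simp [ex_eq, setInd_apply, QA, QB, QC, UA, UB, UC] at hQ hrow
  simp only [tripleList, List.mem_cons, Prod.mk.injEq, List.not_mem_nil, or_false] at hUVX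
  rcases hUVX with ⟨rfl, rfl, rfl⟩ | ⟨rfl, rfl, rfl⟩ | ⟨rfl, rfl, rfl⟩ | ⟨rfl, rfl, rfl⟩ | ⟨rfl, rfl, rfl⟩ |
    ⟨rfl, rfl, rfl⟩ | ⟨rfl, rfl, rfl⟩ | ⟨rfl, rfl, rfl⟩ | ⟨rfl, rfl, rfl⟩ | ⟨rfl, rfl, rfl⟩ | ⟨rfl, rfl, rfl⟩ |
    ⟨rfl, rfl, rfl⟩ | ⟨rfl, rfl, rfl⟩ | ⟨rfl, rfl, rfl⟩ | ⟨rfl, rfl, rfl⟩ | ⟨rfl, rfl, rfl⟩ | ⟨rfl, rfl, rfl⟩ |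
    ⟨rfl, rfl, rfl⟩ | ⟨rfl, rfl, rfl⟩ | ⟨rfl, rfl, rfl⟩ | ⟨rfl, rfl, rfl⟩ | ⟨rfl, rfl, rfl⟩ | ⟨rfl, rfl, rfl⟩ |
    ⟨rfl, rfl, rfl⟩ | ⟨rfl, rfl, rfl⟩ | ⟨rfl, rfl, rfl⟩ | ⟨rfl, rfl, rfl⟩ | ⟨rfl, rfl, rfl⟩ | ⟨rfl, rfl, rfl⟩ |
    ⟨rfl, rfl, rfl⟩ | ⟨rfl, rfl, rfl⟩ | ⟨rfl, rfl, rfl⟩ | ⟨rfl, rfl, rfl⟩ | ⟨rfl, rfl, rfl⟩ | ⟨rfl, rfl, rfl⟩ |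
    ⟨rfl, rfl, rfl⟩
  all_goals
    rw [sahiE_three]
    simp [ex_eq, setInd_apply, QA, QB, QC, UA, UB, UC, UAt, UCt, M]
    linarith

/-- **Sahi positivity of every order on `P7` from order `2` and the single row cubic.** [this work] -/
theorem sahiPositive_of_two_of_cubic {ν : P7 → ℝ} (hν0 : ∀ x, 0 ≤ ν x) (hν1 : ∑ x, ν x = 1)
    (h2 : SahiPositive ν 2) (h3 : 0 ≤ sahiE ν 3 ![setInd UA, setInd UB, setInd UC]) (n : ℕ) : SahiPositive ν n := by
  refine sahiPositive_of_antichainBasis₂ hν0 hν1 ?_ n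
  intro k U hU hanti
  have hU' : ∀ i, U i ∈ ups := fun i => (isUp_iff_mem_ups _).1 ((isUp_iff _).1 (hU i))
  match k with
  | 0 =>
    have hfam : (fun i => setInd (U i)) = ![setInd (U 0), setInd (U 1)] := by funext i; fin_cases i <;> rfl
    rw [hfam]
    exact sahiE_two_nonneg_of_two h2 (hU 0) (hU 1)
  | 1 =>
    have hmem := antichain_three_mem (U 0) (hU' 0) (U 1) (hU' 1) (U 2) (hU' 2)
      (hanti (show (1 : Fin 3) ≠ 0 by decide)) (hanti (show (0 : Fin 3) ≠ 1 by decide))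
      (hanti (show (2 : Fin 3) ≠ 0 by decide)) (hanti (show (0 : Fin 3) ≠ 2 by decide))
      (hanti (show (2 : Fin 3) ≠ 1 by decide)) (hanti (show (1 : Fin 3) ≠ 2 by decide))
    have hfam : (fun i => setInd (U i)) = ![setInd (U 0), setInd (U 1), setInd (U 2)] := by
      funext i; fin_cases i <;> rfl
    rw [hfam]
    exact sahiE_three_nonneg_of_mem_tripleList hν0 hν1 h2 h3 hmem
  | k + 2 =>
    exfalso
    obtain ⟨i, j, hij, hsub⟩ := nested_of_four U hU
    exact hanti hij hsub

/-- **Theorem (three events with one covering relation).**  For a probability weight `ν` on `P7 = {0,1}³ ∖ {010}`: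
Sahi positivity of EVERY order holds iff it holds at order `2` and the single cubic
`E₃(χ_{U_A}, χ_{U_B}, χ_{U_C}) ≥ 0` (the "row") holds. [this work] -/
theorem sahiPositive_iff_two_and_cubic {ν : P7 → ℝ} (hν0 : ∀ x, 0 ≤ ν x) (hν1 : ∑ x, ν x = 1) :
    (∀ n, SahiPositive ν n) ↔ SahiPositive ν 2 ∧ 0 ≤ sahiE ν 3 ![setInd UA, setInd UB, setInd UC] := by
  constructor
  · intro hall
    refine ⟨hall 2, ?_⟩
    have h3 := (sahiPositive_iff_indicators ν 3).1 (hall 3) ![UA, UB, UC] (fun i => by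
      fin_cases i
      · exact isUpperSet_UA
      · exact isUpperSet_UB
      · exact isUpperSet_UC)
    have e : (fun i => setInd ((![UA, UB, UC] : Fin 3 → Finset P7) i)) = ![setInd UA, setInd UB, setInd UC] := by
      funext i; fin_cases i <;> rfl
    rw [e] at h3
    exact h3
  · rintro ⟨h2, h3⟩ n
    exact sahiPositive_of_two_of_cubic hν0 hν1 h2 h3 n

end Weight

end P7
end Summit.CriticalPhenomena.PercolationContinuityZ3.Theorems.SahiDeltaSystem
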